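import Mathlib.MeasureTheory.Function.LocallyIntegrable
import Mathlib.MeasureTheory.Group.Measure
import HarnessLib

/-!
# F0 · P3c · ROAD «HC-D» (holder F0P2-p01) — D7-prep «LOCAL INTEGRABILITY FROM LOCAL `∫⁻` BOUNDS, AND ITS TRANSPORT»: the three generic lemmas the terminal file D7 uses to turn
# the road's `∫⁻ … < ∞` outputs on the model group into `LocallyIntegrable` of the real-valued `hDGliO` integrand on `Gqs L v`

Cell `pub/hodgecm-mathlib`, crux H413 = `stmt-HodgeConjecture-24833` (lane `--supports … --as helper`), route HCCMUnconditional; ROAD «HC-D» (LEAD T14-10), brick D7-prep.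
THEOREMS ONLY, Mathlib-only.  HONEST LABEL: HC_CM is proved only modulo the 7 printed citations (2 remaining named inputs: hLiu418 = `stmt-HodgeConjecture-24832`, h413 =
`stmt-HodgeConjecture-24833`) until rung 0 closes; count-neutral.

* §1 `locallyIntegrable_of_forall_exists_setLIntegral_lt_top` — a (strongly measurable) `f : X → E` with `‖f x‖ₑ ≤ T x` and «every point has a neighbourhood `U` with `∫⁻_U T < ∞`»
  is locally integrable.  (The road's outputs are exactly such neighbourhood bounds for the `ℝ≥0∞`-token `T`; RULING R2.)
* §2 `enorm_inv_coe_le_inv_coe` — for `r : ℝ≥0`, `‖((r : ℝ))⁻¹‖ₑ ≤ (↑r : ℝ≥0∞)⁻¹` (equality for `r ≠ 0`; at `r = 0` the real inverse is `0` and the token is `⊤`): the pointwise comparison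
  between the REAL `hDGliO` integrand `(√√(…))⁻¹` and the road's `ℝ≥0∞` token — no null-set argument is ever needed.
* §3 `forall_exists_setLIntegral_comp_lt_top_of_map` — transport of neighbourhood bounds along a homeomorphism `e : X ≃ₜ Y` (Borel): if every `y` has `U' ∈ 𝓝 y` with
  `∫⁻_{U'} T ∂(μ.map e) < ∞` then every `x` has `U ∈ 𝓝 x` with `∫⁻_U (T ∘ e) ∂μ < ∞` (used with `e = localNonsplitEquiv`, `μ = νQv`).

## References
* [HarishChandra1970] Harish-Chandra (van Dijk), LNM 162 (1970), Part VII §1 Thm. 15 — the statement D7 pays; context only.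
* [Folland1999] G. B. Folland, *Real Analysis* (2nd ed. 1999), §2.3 (integrability via `∫ |f| < ∞`), Thm. 2.15 (monotonicity) — folklore locators.
-/

set_option autoImplicit false
-- the mandated namespace has the single-problem summit's repeated segment (`HodgeConjecture.HodgeConjecture`)
set_option linter.dupNamespace false

noncomputable section

open MeasureTheory Filter Set Topology
open scoped ENNReal NNReal

namespace Summit.HodgeConjecture.HodgeConjecture.Cruxes.H413.F0P3cStCharTSHCDLocIntTransport

/-! ## §1 Local integrability from neighbourhood `∫⁻` bounds on a majorant -/

section LocInt

variable {X : Type*} [TopologicalSpace X] [MeasurableSpace X] {E : Type*} [NormedAddCommGroup E]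

/-- **Local integrability from local `∫⁻` bounds.**  If `f` is a.e.-strongly measurable, `‖f x‖ₑ ≤ T x` everywhere, and every point has a neighbourhood on which `∫⁻ T < ∞`,
then `f` is locally integrable. [folklore] -/
theorem locallyIntegrable_of_forall_exists_setLIntegral_lt_top {μ : Measure X} {f : X → E} (hf : AEStronglyMeasurable f μ) (T : X → ℝ≥0∞)
    (hle : ∀ x, ‖f x‖ₑ ≤ T x) (hT : ∀ x, ∃ U ∈ 𝓝 x, ∫⁻ y in U, T y ∂μ < ∞) :
    LocallyIntegrable f μ := by
  intro x
  obtain ⟨U, hU, hfin⟩ := hT x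
  refine ⟨U, hU, ?_⟩
  refine ⟨hf.restrict, ?_⟩
  refine lt_of_le_of_lt (lintegral_mono fun y => hle y) hfin

end LocInt

/-! ## §2 The pointwise comparison `‖(↑r)⁻¹‖ₑ ≤ (↑r)⁻¹` -/

/-- For `r : ℝ≥0`: `‖((r : ℝ))⁻¹‖ₑ ≤ (↑r : ℝ≥0∞)⁻¹` — equality when `r ≠ 0`, and `0 ≤ ⊤` when `r = 0` (real `0⁻¹ = 0`). [folklore] -/
theorem enorm_inv_coe_le_inv_coe (r : ℝ≥0) : ‖((r : ℝ))⁻¹‖ₑ ≤ ((r : ℝ≥0∞))⁻¹ := by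
  rcases eq_or_ne r 0 with hr | hr
  · simp [hr]
  · have hr' : (0 : ℝ) < r := by exact_mod_cast pos_iff_ne_zero.2 hr
    rw [Real.enorm_eq_ofReal (inv_nonneg.2 hr'.le), ENNReal.ofReal_inv_of_pos hr', ENNReal.ofReal_coe_nnreal]

/-- The same comparison composed with any `ℝ≥0`-valued function: `‖((g x : ℝ))⁻¹‖ₑ ≤ (↑(g x))⁻¹`. [folklore] -/
theorem enorm_inv_coe_apply_le {X : Type*} (g : X → ℝ≥0) (x : X) : ‖((g x : ℝ))⁻¹‖ₑ ≤ ((g x : ℝ≥0∞))⁻¹ :=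
  enorm_inv_coe_le_inv_coe (g x)

/-! ## §3 Transport of neighbourhood `∫⁻` bounds along a homeomorphism -/

section Transport

variable {X Y : Type*} [TopologicalSpace X] [MeasurableSpace X] [BorelSpace X] [TopologicalSpace Y] [MeasurableSpace Y] [BorelSpace Y]

/-- **Transport of local `∫⁻` bounds along a homeomorphism.**  `e : X ≃ₜ Y`, `μ` a measure on `X`: if every `y : Y` has a neighbourhood `U'` with `∫⁻_{U'} T ∂(μ.map e) < ∞`,
then every `x : X` has a neighbourhood `U` with `∫⁻_U (T ∘ e) ∂μ < ∞` (namely `U = e ⁻¹' U'`). [folklore] -/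
theorem forall_exists_setLIntegral_comp_lt_top_of_map (e : X ≃ₜ Y) (μ : Measure X) (T : Y → ℝ≥0∞)
    (hT : ∀ y, ∃ U' ∈ 𝓝 y, ∫⁻ z in U', T z ∂(μ.map e) < ∞) :
    ∀ x, ∃ U ∈ 𝓝 x, ∫⁻ z in U, T (e z) ∂μ < ∞ := by
  intro x
  obtain ⟨U', hU', hfin⟩ := hT (e x)
  refine ⟨e ⁻¹' U', e.continuous.continuousAt.preimage_mem_nhds hU', ?_⟩
  have hme : MeasurableEmbedding e := e.toMeasurableEquiv.measurableEmbedding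
  have : ∫⁻ z in U', T z ∂(μ.map e) = ∫⁻ z in e ⁻¹' U', T (e z) ∂μ := by
    rw [hme.restrict_map, hme.lintegral_map]
  rw [← this]
  exact hfin

/-- Group version: for `e : G ≃ₜ* H` the transported Haar-type measure is `ν.map e`; same conclusion (a restatement for `ContinuousMulEquiv`). [folklore] -/
theorem forall_exists_setLIntegral_comp_lt_top_of_map_mulEquiv {G H : Type*} [TopologicalSpace G] [MeasurableSpace G] [BorelSpace G] [Mul G]
    [TopologicalSpace H] [MeasurableSpace H] [BorelSpace H] [Mul H]
    (e : G ≃ₜ* H) (ν : Measure G) (T : H → ℝ≥0∞)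
    (hT : ∀ h, ∃ U' ∈ 𝓝 h, ∫⁻ z in U', T z ∂(ν.map e) < ∞) :
    ∀ g, ∃ U ∈ 𝓝 g, ∫⁻ z in U, T (e z) ∂ν < ∞ :=
  forall_exists_setLIntegral_comp_lt_top_of_map e.toHomeomorph ν T hT

end Transport

end Summit.HodgeConjecture.HodgeConjecture.Cruxes.H413.F0P3cStCharTSHCDLocIntTransport

end
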